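import Summits.QuantumFields.YangMills.Theorems.BalabanLadderROTSkewTorus
import Literature.MathematicalPhysics.QuantumLattice.LatticeGaugeDLRGibbsProofs
import HarnessLib

/-!
# Crux `ROT` (stmt-QuantumFields-20042): the DLR equations for Wilson's measure on a SKEW torus `ℤᵈ/P`

Helper file of the fleet lead `ym-spine-20042-p1` (generation g4), `--supports stmt-QuantumFields-20042` (count-neutral).

WHY.  After the tilt split of the rotation leg (`Theorems/BalabanLadderROTTiltSplit.lean`, p469977: `KingOnClass ⇐ NROT3 ∧ TI`)
the infrared half `TI` compares the AXIS Wilson theory on the straight torus `ℤ⁴/(2L+1)ℤ⁴` with the axis Wilson theory on the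
TILTED torus `ℤ⁴/P`, `P = m·rotZinv(ℤ⁴)` (`PeriodCell.measure` of `Theorems/BalabanLadderROTSkewTorus.lean`, p469539), i.e. two
finite-volume Gibbs states of the SAME specification (the lattice Yang–Mills kernels `ymSpecification ρ β Λ η` of `ℤᵈ`) with two
different periodic identifications.  Every argument comparing them (decay of boundary influence, cluster expansions, complete
analyticity — whatever infrared input the owner eventually files for `TI`) enters through the DLR equations of the two torus states.
The tree has them for the straight torus only (`wilsonExpectation_toTorusObservable_eq`, `LatticeGaugeDLRGibbsProofs.lean`, hard-wired
to `Fin d → ZMod L`).  This file proves them for EVERY period cell: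

* §1 bookkeeping `ℤᵈ ↔ ℤᵈ/P` through the transversal (`shift_toRep`, `holonomy_toRep`, injectivity of the edge / plaquette maps
  over a set of base points on which the reduction `red` is injective, near/far split of the skew-torus action, lift of a resampled
  configuration = gluing);
* §2 the skew-torus expectation as a weighted product-Haar integral (`integral_measure_eq_toReal_mul_integral`);
* §3 **the DLR equations** `integral_lift_eq_integral_kernel_lift`: for a bounded continuous cylinder observable `F` of `ℤᵈ` with support
  `S₀` and a finite edge set `Λ` such that `red` is injective on the base points of `Λ ∪ S₀ ∪ ∂Λ`,
  `∫ F(Ũ) dμ_C(U) = ∫ (γ_Λ F)(Ũ) dμ_C(U)` (`Ũ = lift U`, `γ_Λ = ymSpecification ρ β Λ`);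
* §4 the door the tilt bracket needs: `mean_eq_mean_kernel` and **`abs_mean_sub_mean_le`** — if the kernel average `η ↦ γ_Λ(O | η)` of
  an observable oscillates by at most `ε` in the boundary condition, then the Wilson means of `O` on ANY two period cells (straight or
  tilted, any sizes) on which `Λ ∪ supp O ∪ ∂Λ` injects differ by at most `2ε`.

The proof of §3 is the tree's proof for the straight torus, transported verbatim: resampling identity on the finite product
(`integral_exp_mul_eq_integral_exp_mul_condAvg`), reindexing along the injection `Λ ↪ edges of ℤᵈ/P` (`pi_map_comp_injective`), and the
kernel formula `integral_ymSpecification`.  Nothing is specific to `d = 4`, to rotations or to Yang–Mills beyond Wilson's action;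
nothing is asserted about the crux.  No instance, no named fact, no sorry.

References: H.-O. Georgii, *Gibbs Measures and Phase Transitions* (2011) Prop. 2.5, (4.18); S. Friedli, Y. Velenik, *Statistical
Mechanics of Lattice Systems* (2017) Lemma 6.7, (6.34) and the remark on periodic boundary conditions before Exercise 6.14;
E. Seiler, LNP 159 (1982) Ch. 2.
-/

set_option autoImplicit false

noncomputable section

open scoped BigOperators ENNReal
open MeasureTheory Filter Topology Finset
open Literature.MathematicalPhysics.QuantumLattice
open Literature.MathematicalPhysics.QuantumFieldTheory (haarProbability)
open Literature.Probability.LatticeModels (Site glueWith glueWith_apply_mem glueWith_apply_not_mem measurable_glueWith)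

namespace Summit.QuantumFields.YangMills.Theorems.ROT

namespace PeriodCell

variable {d : ℕ} (C : PeriodCell d)

/-! ## §1 Bookkeeping: `ℤᵈ` versus the skew torus `ℤᵈ/P` -/

/-- The neighbour map of the skew torus is compatible with representatives: `shift (toRep x) i = toRep (x + eᵢ)`. -/
theorem shift_toRep (x : Site d) (i : Fin d) : C.shift (C.toRep x) i = C.toRep (x + Pi.single i 1) := by
  unfold shift
  rw [coe_toRep, toRep_eq_toRep_iff]
  have h : C.red x + Pi.single i 1 - (x + Pi.single i 1) = C.red x - x := by abel
  rw [h]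
  exact C.red_sub_mem x

/-- If `toRep x` is the `i`-neighbour of the torus site `y`, then `toRep (x - eᵢ) = y`. -/
theorem toRep_sub_single_of_eq_shift {y : C.TSite} {x : Site d} {i : Fin d} (h : C.toRep x = C.shift y i) :
    C.toRep (x - Pi.single i 1) = y := by
  rw [shift, toRep_eq_toRep_iff] at h
  rw [← C.toRep_coe y, toRep_eq_toRep_iff]
  have h' : x - Pi.single i 1 - (y : Site d) = x - ((y : Site d) + Pi.single i 1) := by abel
  rw [h']
  exact h

variable {G : Type*} [Group G]

/-- Holonomies are compatible with the periodic lift: the skew-torus holonomy at `toRep x` is the `ℤᵈ` holonomy of the lifted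
configuration at `x`. -/
theorem holonomy_toRep (U : C.Config G) (x : Site d) (i j : Fin d) :
    C.holonomy U (C.toRep x) i j = plaquetteHolonomyZd (C.lift U) x i j := by
  simp only [holonomy, plaquetteHolonomyZd, lift_apply, shift_toRep]

omit [Group G] in
/-- The edge map `(x, i) ↦ (toRep x, i)` to the skew torus is injective on a finite edge set as soon as the reduction `red` is
injective on its base points. -/
theorem injOn_cellEdge {T : Finset (ZdEdge d)} (hT : Set.InjOn C.red (T.image Prod.fst : Set (Site d))) :
    Set.InjOn (fun e : ZdEdge d => ((C.toRep e.1, e.2) : C.TEdge)) ↑T := by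
  intro e₁ h₁ e₂ h₂ h
  simp only [Prod.mk.injEq] at h
  refine Prod.ext (hT ?_ ?_ (congrArg Subtype.val h.1)) h.2
  · exact mem_coe.2 (mem_image_of_mem _ h₁)
  · exact mem_coe.2 (mem_image_of_mem _ h₂)

omit [Group G] in
/-- A skew-torus plaquette `q = (y, i, j)` one of whose four edges `(y, i), (shift y i, j), (shift y j, i), (y, j)` lies below an edge
`e ∈ Λ` lies below a plaquette of `ℤᵈ` touching `Λ`. -/
theorem exists_cellPlaq_eq_of_cellEdge_eq {Λ : Finset (ZdEdge d)} {e : ZdEdge d} (he : e ∈ Λ) (q : C.TPlaq)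
    (hq : ((C.toRep e.1, e.2) : C.TEdge) = (q.1, q.2.1.1) ∨ ((C.toRep e.1, e.2) : C.TEdge) = (C.shift q.1 q.2.1.1, q.2.1.2) ∨
      ((C.toRep e.1, e.2) : C.TEdge) = (C.shift q.1 q.2.1.2, q.2.1.1) ∨ ((C.toRep e.1, e.2) : C.TEdge) = (q.1, q.2.1.2)) :
    ∃ p ∈ plaquettesTouching Λ, ((C.toRep p.1, p.2) : C.TPlaq) = q := by
  obtain ⟨x, k⟩ := e
  obtain ⟨y, ij⟩ := q
  simp only [Prod.mk.injEq] at hq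
  rcases hq with ⟨h1, h2⟩ | ⟨h1, h2⟩ | ⟨h1, h2⟩ | ⟨h1, h2⟩
  · refine ⟨(x, ij), mem_plaquettesTouching_iff.2 ⟨(x, k), mem_inter.2 ⟨?_, he⟩⟩, ?_⟩
    · simp [plaquetteEdges, h2]
    · simp [h1]
  · refine ⟨(x - Pi.single ij.1.1 1, ij),
      mem_plaquettesTouching_iff.2 ⟨(x, k), mem_inter.2 ⟨?_, he⟩⟩, ?_⟩
    · simp [plaquetteEdges, h2]
    · simp [C.toRep_sub_single_of_eq_shift h1]
  · refine ⟨(x - Pi.single ij.1.2 1, ij),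
      mem_plaquettesTouching_iff.2 ⟨(x, k), mem_inter.2 ⟨?_, he⟩⟩, ?_⟩
    · simp [plaquetteEdges, h2]
    · simp [C.toRep_sub_single_of_eq_shift h1]
  · refine ⟨(x, ij), mem_plaquettesTouching_iff.2 ⟨(x, k), mem_inter.2 ⟨?_, he⟩⟩, ?_⟩
    · simp [plaquetteEdges, h2]
    · simp [h1]

omit [Group G] in
/-- The plaquette map `(x, (i, j)) ↦ (toRep x, (i, j))` to the skew torus is injective on the plaquettes touching `Λ` once `red` is
injective on the base points of their edges. -/
theorem injOn_cellPlaq {Λ : Finset (ZdEdge d)} {B : Finset (Site d)}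
    (hB : ((plaquettesTouching Λ).biUnion plaquetteEdges).image Prod.fst ⊆ B)
    (hred : Set.InjOn C.red (B : Set (Site d))) :
    Set.InjOn (fun p : ZdPlaquette d => ((C.toRep p.1, p.2) : C.TPlaq)) ↑(plaquettesTouching Λ) := by
  intro p₁ h₁ p₂ h₂ h
  simp only [Prod.mk.injEq] at h
  refine Prod.ext (hred ?_ ?_ (congrArg Subtype.val h.1)) h.2
  · exact hB (fst_mem_image_of_mem_plaquettesTouching h₁)
  · exact hB (fst_mem_image_of_mem_plaquettesTouching h₂)

variable {N : ℕ} (ρ : G →* Matrix (Fin N) (Fin N) ℂ)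

/-- **Near part of the skew-torus action.**  If the plaquette map is injective on the plaquettes touching `Λ`, the skew-torus
plaquette terms `N − Re tr ρ(V_q)` over their images sum to the boundary Wilson action `S_Λ` of the lifted configuration. -/
theorem sum_image_cellPlaq_term {Λ : Finset (ZdEdge d)}
    (hinj : Set.InjOn (fun p : ZdPlaquette d => ((C.toRep p.1, p.2) : C.TPlaq)) ↑(plaquettesTouching Λ)) (V : C.Config G) :
    ∑ q ∈ (plaquettesTouching Λ).image (fun p : ZdPlaquette d => ((C.toRep p.1, p.2) : C.TPlaq)),
        ((N : ℝ) - (ρ (C.holonomy V q.1 q.2.1.1 q.2.1.2)).trace.re) =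
      wilsonBoundaryAction ρ Λ (C.lift V) := by
  classical
  rw [sum_image hinj, wilsonBoundaryAction]
  refine sum_congr rfl fun p _ => ?_
  simp only [plaquetteObs, holonomy_toRep]

/-- **Far part of the skew-torus action.**  A skew-torus plaquette that is not the image of a plaquette touching `Λ` has no edge
below `Λ`, so its holonomy is unchanged when the edges below `Λ` are resampled. -/
theorem holonomy_piecewise_of_ne {Λ : Finset (ZdEdge d)} {q : C.TPlaq}
    (hq : ∀ p ∈ plaquettesTouching Λ, ((C.toRep p.1, p.2) : C.TPlaq) ≠ q) (W V : C.Config G) :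
    C.holonomy ((Λ.image (fun e : ZdEdge d => ((C.toRep e.1, e.2) : C.TEdge))).piecewise W V) q.1 q.2.1.1 q.2.1.2 =
      C.holonomy V q.1 q.2.1.1 q.2.1.2 := by
  classical
  have key : ∀ e' : C.TEdge,
      (e' = (q.1, q.2.1.1) ∨ e' = (C.shift q.1 q.2.1.1, q.2.1.2) ∨ e' = (C.shift q.1 q.2.1.2, q.2.1.1) ∨ e' = (q.1, q.2.1.2)) →
      (Λ.image (fun e : ZdEdge d => ((C.toRep e.1, e.2) : C.TEdge))).piecewise W V e' = V e' := fun e' h' =>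
    piecewise_eq_of_notMem _ _ _ fun hmem => by
      obtain ⟨e, he, rfl⟩ := mem_image.1 hmem
      obtain ⟨p, hp, hpq⟩ := C.exists_cellPlaq_eq_of_cellEdge_eq he q h'
      exact hq p hp hpq
  simp only [holonomy]
  rw [key _ (Or.inl rfl), key _ (Or.inr (Or.inl rfl)), key _ (Or.inr (Or.inr (Or.inl rfl))),
    key _ (Or.inr (Or.inr (Or.inr rfl)))]

omit [Group G] in
/-- **Lift of a resampled skew-torus configuration.**  On an edge set `T ⊇ Λ` of `ℤᵈ` on which the edge map is injective, lifting
the configuration whose edges below `Λ` are taken from `W` agrees with gluing `W` (read below `Λ`) on `Λ` into the lift of `V`. -/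
theorem lift_piecewise_apply {Λ T : Finset (ZdEdge d)} (hΛT : Λ ⊆ T)
    (hinj : Set.InjOn (fun e : ZdEdge d => ((C.toRep e.1, e.2) : C.TEdge)) ↑T) (W V : C.Config G)
    {e : ZdEdge d} (he : e ∈ T) :
    C.lift ((Λ.image (fun e : ZdEdge d => ((C.toRep e.1, e.2) : C.TEdge))).piecewise W V) e =
      glueWith Λ (fun e' : ↥Λ => W (C.toRep (e' : ZdEdge d).1, (e' : ZdEdge d).2)) (C.lift V) e := by
  classical
  rw [lift_apply]
  by_cases heΛ : e ∈ Λ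
  · rw [piecewise_eq_of_mem _ _ _ (mem_image_of_mem (fun e : ZdEdge d => ((C.toRep e.1, e.2) : C.TEdge)) heΛ),
      glueWith_apply_mem _ _ _ heΛ]
  · rw [glueWith_apply_not_mem _ _ _ heΛ, lift_apply, piecewise_eq_of_notMem]
    intro hmem
    obtain ⟨e'', he'', h⟩ := mem_image.1 hmem
    exact heΛ (hinj (hΛT he'') he h ▸ he'')

/-! ## §2 The skew-torus expectation as a weighted product-Haar integral -/

variable [TopologicalSpace G] [IsTopologicalGroup G] [CompactSpace G] [MeasurableSpace G] [BorelSpace G]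

omit [CompactSpace G] [MeasurableSpace G] [BorelSpace G] in
/-- The skew-torus plaquette terms `N − Re tr ρ(V_q)` are continuous for continuous `ρ`. [folklore] -/
theorem continuous_holonomyTerm (hρ : Continuous ρ) (q : C.TPlaq) :
    Continuous fun V : C.Config G => (N : ℝ) - (ρ (C.holonomy V q.1 q.2.1.1 q.2.1.2)).trace.re := by
  have h : Continuous fun V : C.Config G => C.holonomy V q.1 q.2.1.1 q.2.1.2 := by
    unfold holonomy; fun_prop
  exact continuous_const.sub (Complex.continuous_re.comp ((hρ.comp h).matrix_trace))

omit [CompactSpace G] [MeasurableSpace G] [BorelSpace G] in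
/-- The skew-torus Wilson action is continuous for continuous `ρ`. [folklore] -/
theorem continuous_action (hρ : Continuous ρ) : Continuous fun V : C.Config G => C.action ρ V :=
  continuous_finsetSum _ fun q _ => C.continuous_holonomyTerm ρ hρ q

omit [Group G] [IsTopologicalGroup G] [CompactSpace G] [MeasurableSpace G] [BorelSpace G] in
/-- The periodic lift of the skew torus is continuous. [folklore] -/
theorem continuous_lift : Continuous (C.lift (G := G)) :=
  continuous_pi fun _ => continuous_apply _

variable [SecondCountableTopology G]

/-- The skew-torus Wilson expectation as a weighted product-Haar integral: `∫ X dμ_C = Z⁻¹ ∫ e^{−β S(V)} X(V) ∏ₑ dV_e`. -/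
theorem integral_measure_eq_toReal_mul_integral (hρ : Continuous ρ) (β : ℝ) (X : C.Config G → ℝ) :
    ∫ U, X U ∂(C.measure (G := G) ρ β) =
      ((C.partitionZ (G := G) ρ β)⁻¹).toReal *
        ∫ V, Real.exp (-β * C.action ρ V) * X V ∂(Measure.pi fun _ : C.TEdge => haarProbability G) := by
  have hmeas : Measurable fun V : C.Config G => ENNReal.ofReal (Real.exp (-β * C.action ρ V)) :=
    ENNReal.measurable_ofReal.comp
      (Real.continuous_exp.comp (continuous_const.mul (C.continuous_action ρ hρ))).measurable
  unfold PeriodCell.measure PeriodCell.weight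
  rw [integral_smul_measure, integral_withDensity_eq_integral_toReal_smul hmeas
    (ae_of_all _ fun _ => ENNReal.ofReal_lt_top), smul_eq_mul]
  congr 1
  refine congrArg _ (funext fun V => ?_)
  rw [ENNReal.toReal_ofReal (Real.exp_pos _).le, smul_eq_mul]

/-! ## §3 Skew-torus Wilson states satisfy the local DLR equations of `ymSpecification` -/

/-- **Wilson states of a skew torus satisfy the local DLR equations of `ymSpecification`.**  Let `F` be a bounded continuous cylinder
observable on `ℤᵈ` with support `S₀`, `Λ` a finite edge set, and let the period cell be so large that the reduction `red` is injective on
the base points of `Λ ∪ S₀ ∪ ∂Λ` (`∂Λ` = edges of the plaquettes touching `Λ`).  Then the skew-torus Wilson state gives the same expectation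
to `F ∘ lift` and to `(γ_Λ F) ∘ lift`: the conditional distribution of the edges below `Λ` given the others is the Wilson kernel, whose
plaquettes and boundary edges inject into the skew torus (Georgii 2011 (4.18); Friedli–Velenik 2017 (6.34), periodic b.c.). -/
theorem integral_lift_eq_integral_kernel_lift (hρ : Continuous ρ) (β : ℝ) (Λ : Finset (ZdEdge d))
    {F : LGConfig d G → ℝ} (hF : Continuous F) {B : ℝ} (hB : ∀ U, |F U| ≤ B)
    {S₀ : Finset (ZdEdge d)} (hFS : IsCylinder F S₀)
    (hred : Set.InjOn C.red ((Λ ∪ S₀ ∪ (plaquettesTouching Λ).biUnion plaquetteEdges).image Prod.fst : Set (Site d))) :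
    ∫ U, F (C.lift U) ∂(C.measure (G := G) ρ β) =
      ∫ U, (∫ W, F W ∂(ymSpecification ρ β Λ (C.lift U))) ∂(C.measure (G := G) ρ β) := by
  classical
  -- the relevant finite edge set `T` and the injectivity consequences of `hred`
  have hΛT : Λ ⊆ Λ ∪ S₀ ∪ (plaquettesTouching Λ).biUnion plaquetteEdges :=
    (subset_union_left).trans subset_union_left
  have hS₀T : S₀ ⊆ Λ ∪ S₀ ∪ (plaquettesTouching Λ).biUnion plaquetteEdges :=
    (subset_union_right).trans subset_union_left
  have hPT : (plaquettesTouching Λ).biUnion plaquetteEdges ⊆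
      Λ ∪ S₀ ∪ (plaquettesTouching Λ).biUnion plaquetteEdges := subset_union_right
  have hTinj := C.injOn_cellEdge hred
  have hPinj := C.injOn_cellPlaq (image_subset_image hPT) hred
  -- near and far parts of the skew-torus action
  set a : C.Config G → ℝ := fun V =>
    -β * ∑ q ∈ (plaquettesTouching Λ).image (fun p : ZdPlaquette d => ((C.toRep p.1, p.2) : C.TPlaq)),
      ((N : ℝ) - (ρ (C.holonomy V q.1 q.2.1.1 q.2.1.2)).trace.re)
    with ha_def
  set b : C.Config G → ℝ := fun V =>
    -β * ∑ q ∈ ((plaquettesTouching Λ).image (fun p : ZdPlaquette d => ((C.toRep p.1, p.2) : C.TPlaq)))ᶜ,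
      ((N : ℝ) - (ρ (C.holonomy V q.1 q.2.1.1 q.2.1.2)).trace.re)
    with hb_def
  have hab : ∀ V, -β * C.action ρ V = a V + b V := fun V => by
    simp only [ha_def, hb_def, PeriodCell.action, ← mul_add, Finset.sum_add_sum_compl]
  have ha : ∀ V, a V = -β * wilsonBoundaryAction ρ Λ (C.lift V) := fun V => by
    simp only [ha_def, C.sum_image_cellPlaq_term ρ hPinj]
  have hb : ∀ W V, b ((Λ.image (fun e : ZdEdge d => ((C.toRep e.1, e.2) : C.TEdge))).piecewise W V) = b V :=
      fun W V => by
    simp only [hb_def]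
    congr 1
    refine Finset.sum_congr rfl fun q hq => ?_
    rw [C.holonomy_piecewise_of_ne (fun p hp h => (Finset.mem_compl.1 hq) (Finset.mem_image.2 ⟨p, hp, h⟩)) W V]
  have hac : Continuous a :=
    continuous_const.mul (continuous_finsetSum _ fun q _ => C.continuous_holonomyTerm ρ hρ q)
  have hbc : Continuous b :=
    continuous_const.mul (continuous_finsetSum _ fun q _ => C.continuous_holonomyTerm ρ hρ q)
  obtain ⟨A, hA⟩ := exists_bound_of_continuous hac
  obtain ⟨B', hB'⟩ := exists_bound_of_continuous hbc
  have hFt : Continuous fun V : C.Config G => F (C.lift V) := hF.comp C.continuous_lift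
  -- transfer of the fibre integrals from `G^Λ` to the skew torus
  have hτ : Function.Injective fun e : ↥Λ => ((C.toRep (e : ZdEdge d).1, (e : ZdEdge d).2) : C.TEdge) :=
    fun e₁ e₂ h => Subtype.ext (hTinj (hΛT e₁.2) (hΛT e₂.2) h)
  have transfer : ∀ Φ : LGConfig d G → ℝ, Continuous Φ →
      DependsOn Φ ↑(Λ ∪ S₀ ∪ (plaquettesTouching Λ).biUnion plaquetteEdges) →
      ∀ V : C.Config G,
        ∫ ζ, Φ (glueWith Λ ζ (C.lift V)) ∂(Measure.pi fun _ : ↥Λ => haarProbability G) =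
          ∫ W, Φ (C.lift ((Λ.image (fun e : ZdEdge d => ((C.toRep e.1, e.2) : C.TEdge))).piecewise W V))
            ∂(Measure.pi fun _ : C.TEdge => haarProbability G) := by
    intro Φ hΦc hΦT V
    have hm : Measurable fun (W : C.Config G) (e : ↥Λ) => W (C.toRep (e : ZdEdge d).1, (e : ZdEdge d).2) :=
      measurable_pi_iff.2 fun e => measurable_pi_apply _
    have hc : Continuous fun ζ : ↥Λ → G => Φ (glueWith Λ ζ (C.lift V)) :=
      hΦc.comp ((continuous_glueWith_prod Λ).comp (Continuous.prodMk_right (C.lift V)))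
    rw [← pi_map_comp_injective (haarProbability G) hτ, integral_map hm.aemeasurable hc.aestronglyMeasurable]
    refine congrArg _ (funext fun W => hΦT fun e he => ?_)
    exact (C.lift_piecewise_apply hΛT hTinj W V he).symm
  -- locality of the two fibre integrands
  have hST : DependsOn (wilsonBoundaryAction (G := G) ρ Λ) ↑(Λ ∪ S₀ ∪ (plaquettesTouching Λ).biUnion plaquetteEdges) :=
    (isCylinder_wilsonBoundaryAction_holds (G := G) ρ Λ).mono (Finset.coe_subset.2 hPT)
  have hFT : DependsOn F ↑(Λ ∪ S₀ ∪ (plaquettesTouching Λ).biUnion plaquetteEdges) :=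
    hFS.mono (Finset.coe_subset.2 hS₀T)
  have hw : Continuous fun U : LGConfig d G => Real.exp (-β * wilsonBoundaryAction ρ Λ U) :=
    Real.continuous_exp.comp (continuous_const.mul (continuous_wilsonBoundaryAction ρ hρ Λ))
  -- the kernel average of `F` at a periodic boundary condition, computed on the skew torus
  have key : ∀ V : C.Config G,
      ∫ U, F U ∂(ymSpecification ρ β Λ (C.lift V)) =
        (∫ W, F (C.lift ((Λ.image (fun e : ZdEdge d => ((C.toRep e.1, e.2) : C.TEdge))).piecewise W V)) *
              Real.exp (a ((Λ.image (fun e : ZdEdge d => ((C.toRep e.1, e.2) : C.TEdge))).piecewise W V))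
            ∂(Measure.pi fun _ : C.TEdge => haarProbability G)) /
          ∫ W, Real.exp (a ((Λ.image (fun e : ZdEdge d => ((C.toRep e.1, e.2) : C.TEdge))).piecewise W V))
            ∂(Measure.pi fun _ : C.TEdge => haarProbability G) := by
    intro V
    rw [integral_ymSpecification ρ hρ β Λ hF.measurable,
      transfer (fun U => F U * Real.exp (-β * wilsonBoundaryAction ρ Λ U)) (hF.mul hw)
        (fun x y h => by simp only [hFT h, hST h]),
      transfer (fun U => Real.exp (-β * wilsonBoundaryAction ρ Λ U)) hw (fun x y h => by simp only [hST h])]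
    simp only [ha]
  -- conclude with the finite-volume DLR identity on the skew torus
  rw [C.integral_measure_eq_toReal_mul_integral ρ hρ β, C.integral_measure_eq_toReal_mul_integral ρ hρ β]
  congr 1
  simp only [key, hab]
  exact integral_exp_mul_eq_integral_exp_mul_condAvg (haarProbability G)
    (Λ.image (fun e : ZdEdge d => ((C.toRep e.1, e.2) : C.TEdge)))
    (F := fun V => F (C.lift V))
    (NF := fun V => ∫ W, F (C.lift ((Λ.image (fun e : ZdEdge d => ((C.toRep e.1, e.2) : C.TEdge))).piecewise W V)) *
      Real.exp (a ((Λ.image (fun e : ZdEdge d => ((C.toRep e.1, e.2) : C.TEdge))).piecewise W V))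
        ∂(Measure.pi fun _ : C.TEdge => haarProbability G))
    (N1 := fun V => ∫ W, Real.exp (a ((Λ.image (fun e : ZdEdge d => ((C.toRep e.1, e.2) : C.TEdge))).piecewise W V))
      ∂(Measure.pi fun _ : C.TEdge => haarProbability G))
    hFt.measurable hac.measurable hbc.measurable (fun V => hB _) hA hB' hb (fun V => rfl) (fun V => rfl)

/-! ## §4 Consequences for the skew-torus means: the door of the tilt bracket -/

/-- **DLR for the skew-torus mean**: the Wilson mean of a bounded continuous cylinder observable `O` equals the Wilson mean of its kernel
average `η ↦ γ_Λ(O | η)`, for every finite `Λ` such that `Λ ∪ supp O ∪ ∂Λ` injects into the cell. -/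
theorem mean_eq_mean_kernel (hρ : Continuous ρ) (β : ℝ) (Λ : Finset (ZdEdge d))
    {O : LGConfig d G → ℝ} (hO : Continuous O) {B : ℝ} (hB : ∀ U, |O U| ≤ B)
    {S₀ : Finset (ZdEdge d)} (hOS : IsCylinder O S₀)
    (hred : Set.InjOn C.red ((Λ ∪ S₀ ∪ (plaquettesTouching Λ).biUnion plaquetteEdges).image Prod.fst : Set (Site d))) :
    C.mean (G := G) ρ β O = C.mean (G := G) ρ β (fun η => ∫ W, O W ∂(ymSpecification ρ β Λ η)) :=
  C.integral_lift_eq_integral_kernel_lift ρ hρ β Λ hO hB hOS hred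

/-- On a probability space, an integrable function within `ε` of a constant has integral within `ε` of that constant. [folklore] -/
theorem abs_integral_sub_const_le {Ω : Type*} [MeasurableSpace Ω] (μ : Measure Ω) [IsProbabilityMeasure μ]
    {g : Ω → ℝ} (hg : Integrable g μ) {c ε : ℝ} (h : ∀ ω, |g ω - c| ≤ ε) : |∫ ω, g ω ∂μ - c| ≤ ε := by
  have hsub : ∫ ω, g ω ∂μ - c = ∫ ω, (g ω - c) ∂μ := by
    rw [integral_sub hg (integrable_const c), integral_const, probReal_univ, one_smul]
  rw [hsub]
  have hbound := norm_integral_le_of_norm_le_const (μ := μ) (f := fun ω => g ω - c) (C := ε)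
    (ae_of_all _ fun ω => by rw [Real.norm_eq_abs]; exact h ω)
  rwa [Real.norm_eq_abs, probReal_univ, mul_one] at hbound

/-- **Boundary-condition insensitivity of the kernel averages gives shape insensitivity of the Wilson means.**  Let `O` be a bounded
continuous cylinder observable of `ℤᵈ`, `Λ` a finite edge set, and suppose the kernel average `η ↦ γ_Λ(O | η)` oscillates by at most
`ε` over all boundary conditions.  Then for ANY two period cells `C₁, C₂` (straight or tilted, of any sizes) on which
`Λ ∪ supp O ∪ ∂Λ` injects, the Wilson means of `O` differ by at most `2ε` (DLR on both cells against a fixed reference boundary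
condition).  This is the form in which an infrared input «decay of boundary influence in physical units» feeds the tilt bracket `TI`. -/
theorem abs_mean_sub_mean_le (C₁ C₂ : PeriodCell d) (hρ : Continuous ρ) (β : ℝ) (Λ : Finset (ZdEdge d))
    {O : LGConfig d G → ℝ} (hO : Continuous O) {B : ℝ} (hB : ∀ U, |O U| ≤ B)
    {S₀ : Finset (ZdEdge d)} (hOS : IsCylinder O S₀)
    (h₁ : Set.InjOn C₁.red ((Λ ∪ S₀ ∪ (plaquettesTouching Λ).biUnion plaquetteEdges).image Prod.fst : Set (Site d)))
    (h₂ : Set.InjOn C₂.red ((Λ ∪ S₀ ∪ (plaquettesTouching Λ).biUnion plaquetteEdges).image Prod.fst : Set (Site d)))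
    {ε : ℝ} (hε : ∀ η η' : LGConfig d G,
      |∫ W, O W ∂(ymSpecification ρ β Λ η) - ∫ W, O W ∂(ymSpecification ρ β Λ η')| ≤ ε) :
    |C₁.mean (G := G) ρ β O - C₂.mean (G := G) ρ β O| ≤ 2 * ε := by
  set g : LGConfig d G → ℝ := fun η => ∫ W, O W ∂(ymSpecification ρ β Λ η) with hg
  haveI := C₁.isProbabilityMeasure_measure (G := G) ρ hρ β
  haveI := C₂.isProbabilityMeasure_measure (G := G) ρ hρ β
  -- reference boundary condition
  set η₀ : LGConfig d G := fun _ => 1 with hη₀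
  have e₁ : C₁.mean (G := G) ρ β O = ∫ U, g (C₁.lift U) ∂(C₁.measure (G := G) ρ β) :=
    C₁.mean_eq_mean_kernel ρ hρ β Λ hO hB hOS h₁
  have e₂ : C₂.mean (G := G) ρ β O = ∫ U, g (C₂.lift U) ∂(C₂.measure (G := G) ρ β) :=
    C₂.mean_eq_mean_kernel ρ hρ β Λ hO hB hOS h₂
  -- the kernel average is continuous (Feller) and bounded by `B`, hence integrable against both torus states
  have hgc : Continuous g := continuous_integral_ymSpecification ρ hρ β Λ hO hB
  have hgB : ∀ η, |g η| ≤ B := fun η => abs_integral_ymSpecification_le ρ hρ β Λ hB η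
  have i₁ : Integrable (fun U => g (C₁.lift U)) (C₁.measure (G := G) ρ β) :=
    integrable_of_bound (hgc.comp C₁.continuous_lift).aestronglyMeasurable fun U => hgB _
  have i₂ : Integrable (fun U => g (C₂.lift U)) (C₂.measure (G := G) ρ β) :=
    integrable_of_bound (hgc.comp C₂.continuous_lift).aestronglyMeasurable fun U => hgB _
  have b₁ : |∫ U, g (C₁.lift U) ∂(C₁.measure (G := G) ρ β) - g η₀| ≤ ε :=
    abs_integral_sub_const_le _ i₁ fun U => hε _ _
  have b₂ : |∫ U, g (C₂.lift U) ∂(C₂.measure (G := G) ρ β) - g η₀| ≤ ε :=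
    abs_integral_sub_const_le _ i₂ fun U => hε _ _
  rw [e₁, e₂]
  have := abs_sub_le (∫ U, g (C₁.lift U) ∂(C₁.measure (G := G) ρ β)) (g η₀) (∫ U, g (C₂.lift U) ∂(C₂.measure (G := G) ρ β))
  rw [abs_sub_comm (g η₀)] at this
  linarith

end PeriodCell

end Summit.QuantumFields.YangMills.Theorems.ROT

end
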